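/-
Origin: expansion seat `planner-pub-hodgecm-landherr-g7-0`, handover #2 v2 2026-08-18T07:00:25Z (`HOME/pub-hodgecm-landherr-g7/lean/LandherrG7/LandherrMatrix.lean`, md5 2cd3b3fa, 453 lines);
landed by the gen-7 packager in gate run 25 as `HodgeCM/Proofs/LandherrMatrix.lean` (import ^import LandherrG7\.→import HodgeCM.Proofs. ×1).
-/
/-
# Landherr's theorem for hermitian MATRICES of arbitrary rank over a CM field

Companion to `LandherrRankN.lean` (Landherr for DIAGONAL hermitian forms of every rank).  This file removes the
word "diagonal":

* §A  every non-degenerate `σ`-hermitian matrix `H` over the CM field `L` (`ᵗ(σH) = H`, `det H ≠ 0`) is congruent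
      over `L` to a diagonal matrix: `∃ G` invertible, `ᵗ(σG) · H · G = diag d` (symmetric Gauss elimination; when
      every diagonal entry vanishes, a transvection first produces the entry `Tr_{L/L₀}(1) = 2 ≠ 0`);
* §B  the positive index of the complex hermitian matrix `τ(H)` — the number of positive eigenvalues
      (`Matrix.IsHermitian.eigenvalues`, Mathlib's spectral theorem) — equals the number of `d i` with `τ(d i) > 0`
      for ANY diagonalisation `d` of `H` over `L` (Sylvester's law of inertia, from `LandherrRankN.card_pos_le_of_congr`);
* §C  **Landherr's theorem** [La36] (Shimura, Doc. Math. 13 (2008) Thm 2.2(i) p. 748: "the isomorphism class of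
      `(V, φ)` is determined by `n`, `{σ_v}` and `d₀(φ)`") for hermitian matrices: two non-degenerate `σ`-hermitian
      matrices `H, H'` of the same size over `L` are congruent over `L` iff `τ(H)` and `τ(H')` have the same number
      of positive eigenvalues at every complex embedding `τ` and `det H ≡ det H'` in `L₀^× / N(L^×)`.

Pure proof: nothing is cited or posited; closure of every theorem = the standard trio.
-/
import Summits.HodgeConjecture.HodgeCM.Proofs.LandherrRankN_3
import Mathlib.LinearAlgebra.Matrix.Transvection
import Mathlib.Analysis.Matrix.Spectrum

set_option autoImplicit false

noncomputable section

open scoped Matrix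
open Literature.AlgebraicGeometry.ShimuraVarieties (conjRingHomK embedding_conjRingHomK)

namespace HodgeCM

namespace LandherrRankN

variable (L : CMField)

/-! ## §A. Symmetric Gauss elimination: congruence to a diagonal matrix over `L` -/

section Elim

variable {ι κ : Type}

/-- (Ported verbatim from the HodgeCMPerL package; no docstring in the source.) -/
theorem cT_cT (A : Matrix ι κ L) : cT L (cT L A) = A := by
  ext i j
  simp [cT_apply]

/-- (Ported verbatim from the HodgeCMPerL package; no docstring in the source.) -/
theorem cT_add (A B : Matrix ι κ L) : cT L (A + B) = cT L A + cT L B := by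
  ext i j
  simp [cT_apply]

/-- (Ported verbatim from the HodgeCMPerL package; no docstring in the source.) -/
theorem cT_neg (A : Matrix ι κ L) : cT L (-A) = -cT L A := by
  ext i j
  simp [cT_apply]

/-- (Ported verbatim from the HodgeCMPerL package; no docstring in the source.) -/
theorem cT_sub (A B : Matrix ι κ L) : cT L (A - B) = cT L A - cT L B := by
  ext i j
  simp [cT_apply]

/-- (Ported verbatim from the HodgeCMPerL package; no docstring in the source.) -/
theorem cT_smul (c : L) (A : Matrix ι κ L) : cT L (c • A) = conjRingHomK L c • cT L A := by
  ext i j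
  simp [cT_apply]

/-- (Ported verbatim from the HodgeCMPerL package; no docstring in the source.) -/
theorem cT_transvection [DecidableEq ι] (i j : ι) (c : L) :
    cT L (Matrix.transvection i j c) = Matrix.transvection j i (conjRingHomK L c) := by
  ext a b
  simp only [cT_apply, Matrix.transvection, Matrix.add_apply, Matrix.one_apply, Matrix.single_apply, map_add,
    apply_ite (conjRingHomK L), map_one, map_zero]
  simp only [eq_comm, and_comm]

/-- A congruent of a hermitian matrix is hermitian. -/
theorem cT_congr [Fintype ι] {G H : Matrix ι ι L} (hH : cT L H = H) : cT L (cT L G * H * G) = cT L G * H * G := by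
  rw [cT_mul, cT_mul, cT_cT, hH, Matrix.mul_assoc]

/-- (Ported verbatim from the HodgeCMPerL package; no docstring in the source.) -/
theorem det_congr_ne_zero [Fintype ι] [DecidableEq ι] {G H : Matrix ι ι L} (hG : IsUnit G.det) (hH : H.det ≠ 0) :
    (cT L G * H * G).det ≠ 0 := by
  rw [Matrix.det_mul, Matrix.det_mul, det_cT]
  exact mul_ne_zero (mul_ne_zero ((map_ne_zero _).mpr hG.ne_zero) hH) hG.ne_zero

/-- (Ported verbatim from the HodgeCMPerL package; no docstring in the source.) -/
theorem hermitian_apply {H : Matrix ι ι L} (hH : cT L H = H) (i j : ι) : conjRingHomK L (H i j) = H j i := by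
  have h := congrFun (congrFun hH j) i
  rwa [cT_apply] at h

/-- Step 1: after a congruence some diagonal entry is non-zero.  If all `H i i = 0`, pick `H i j ≠ 0` and use the
transvection with column `eᵢ + (H i j)⁻¹ eⱼ`: the new `(i,i)` entry is `Tr(1) = 2`. -/
theorem exists_congr_apply_ne_zero [Fintype ι] [DecidableEq ι] [Nonempty ι] (H : Matrix ι ι L) (hH : cT L H = H) (hdet : H.det ≠ 0) :
    ∃ G : Matrix ι ι L, IsUnit G.det ∧ ∃ i₀, (cT L G * H * G) i₀ i₀ ≠ 0 := by
  by_cases hdiag : ∃ i, H i i ≠ 0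
  · obtain ⟨i, hi⟩ := hdiag
    exact ⟨1, by simp, i, by rwa [cT_one, Matrix.one_mul, Matrix.mul_one]⟩
  · simp only [not_exists, not_not] at hdiag
    have hH0 : H ≠ 0 := by
      rintro rfl
      exact hdet Matrix.det_zero
    obtain ⟨i, j, hij⟩ : ∃ i j, H i j ≠ 0 := by
      by_contra h
      simp only [not_exists, not_not] at h
      exact hH0 (Matrix.ext fun i j => h i j)
    have hne : i ≠ j := by
      rintro rfl
      exact hij (hdiag i)
    refine ⟨Matrix.transvection j i (H i j)⁻¹, ?_, i, ?_⟩
    · rw [Matrix.det_transvection_of_ne _ _ hne.symm]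
      exact isUnit_one
    · rw [cT_transvection, Matrix.mul_transvection_apply_same, Matrix.transvection_mul_apply_same,
        Matrix.transvection_mul_apply_same, hdiag i, hdiag j, ← hermitian_apply L hH i j, mul_zero, add_zero,
        zero_add, ← map_mul, inv_mul_cancel₀ hij, map_one]
      norm_num

/-- Transport of a congruence along a bijection of the index set. -/
theorem congr_submatrix [Fintype ι] [Fintype κ] (e : κ ≃ ι) (K G D : Matrix κ κ L) (h : cT L G * K * G = D) :
    cT L (G.submatrix e.symm e.symm) * K.submatrix e.symm e.symm * G.submatrix e.symm e.symm =
      D.submatrix e.symm e.symm := by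
  rw [cT_submatrix, Matrix.submatrix_mul_equiv, Matrix.submatrix_mul_equiv, h]

/-- (Ported verbatim from the HodgeCMPerL package; no docstring in the source.) -/
theorem submatrix_submatrix_symm (e : κ ≃ ι) (H : Matrix ι ι L) :
    (H.submatrix e e).submatrix e.symm e.symm = H := by
  ext i j
  simp

/-- Step 2 (one symmetric elimination): the block identity
`ᵗσP · [[A, B], [C, c]] · P = [[A − c⁻¹ BC, 0], [0, c]]` for `P = [[1, 0], [−c⁻¹ C, 1]]`, `ᵗσC = B`, `σc = c ≠ 0`. -/
theorem schur_step [Fintype κ] [DecidableEq κ] (A : Matrix κ κ L) (B : Matrix κ (Fin 1) L) (C : Matrix (Fin 1) κ L) {c : L} (hc : c ≠ 0)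
    (hσc : conjRingHomK L c = c) (hCB : cT L C = B) :
    cT L (Matrix.fromBlocks 1 0 (-(c⁻¹ • C)) (1 : Matrix (Fin 1) (Fin 1) L)) *
        Matrix.fromBlocks A B C (c • (1 : Matrix (Fin 1) (Fin 1) L)) *
        Matrix.fromBlocks 1 0 (-(c⁻¹ • C)) (1 : Matrix (Fin 1) (Fin 1) L) =
      Matrix.fromBlocks (A - c⁻¹ • (B * C)) 0 0 (c • (1 : Matrix (Fin 1) (Fin 1) L)) := by
  rw [cT_fromBlocks, cT_one, cT_one, cT_zero, cT_neg, cT_smul, hCB, map_inv₀, hσc]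
  simp only [Matrix.fromBlocks_multiply, Matrix.one_mul, Matrix.mul_one, Matrix.zero_mul, Matrix.mul_zero,
    add_zero, zero_add, Matrix.neg_mul, Matrix.mul_neg, Matrix.smul_mul, Matrix.mul_smul, smul_neg, smul_smul,
    inv_mul_cancel₀ hc, mul_inv_cancel₀ hc, one_smul, add_neg_cancel, smul_zero, neg_zero, sub_eq_add_neg]

/-- Blocks of a hermitian matrix over `κ ⊕ Fin 1`. -/
theorem blocks_of_hermitian {K : Matrix (κ ⊕ Fin 1) (κ ⊕ Fin 1) L} (hK : cT L K = K) :
    cT L K.toBlocks₁₁ = K.toBlocks₁₁ ∧ cT L K.toBlocks₂₁ = K.toBlocks₁₂ ∧ cT L K.toBlocks₁₂ = K.toBlocks₂₁ ∧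
      cT L K.toBlocks₂₂ = K.toBlocks₂₂ := by
  have h := hK
  rw [← Matrix.fromBlocks_toBlocks K, cT_fromBlocks, Matrix.fromBlocks_inj] at h
  rw [← Matrix.fromBlocks_toBlocks K]
  simp only [Matrix.toBlocks_fromBlocks₁₁, Matrix.toBlocks_fromBlocks₁₂, Matrix.toBlocks_fromBlocks₂₁,
    Matrix.toBlocks_fromBlocks₂₂]
  exact ⟨h.1, h.2.1, h.2.2.1, h.2.2.2⟩

/-- (Ported verbatim from the HodgeCMPerL package; no docstring in the source.) -/
theorem toBlocks₂₂_eq_smul_one (K : Matrix (κ ⊕ Fin 1) (κ ⊕ Fin 1) L) :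
    K.toBlocks₂₂ = K (Sum.inr 0) (Sum.inr 0) • (1 : Matrix (Fin 1) (Fin 1) L) := by
  ext i j
  have hi := Subsingleton.elim i 0
  have hj := Subsingleton.elim j 0
  subst hi hj
  simp [Matrix.toBlocks₂₂]

/-- **Congruence to a diagonal matrix** (induction on the size). -/
theorem exists_congr_diagonal_aux : ∀ (n : ℕ) (ι : Type) [Fintype ι] [DecidableEq ι], Fintype.card ι = n →
    ∀ H : Matrix ι ι L, cT L H = H → H.det ≠ 0 →
    ∃ G : Matrix ι ι L, IsUnit G.det ∧ ∃ d : ι → L, cT L G * H * G = Matrix.diagonal d := by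
  intro n
  induction n with
  | zero =>
    intro ι _ _ hcard H _ _
    haveI : IsEmpty ι := Fintype.card_eq_zero_iff.mp hcard
    exact ⟨1, by simp, fun _ => 0, Matrix.ext fun i _ => (IsEmpty.false i).elim⟩
  | succ m ih =>
    intro ι _ _ hcard H hH hdet
    haveI : Nonempty ι := Fintype.card_pos_iff.mp (by omega)
    -- Step 1
    obtain ⟨G₁, hG₁, i₀, hi₀⟩ := exists_congr_apply_ne_zero L H hH hdet
    set H₁ := cT L G₁ * H * G₁ with hH₁def
    have hH₁ : cT L H₁ = H₁ := cT_congr L hH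
    have hdet₁ : H₁.det ≠ 0 := det_congr_ne_zero L hG₁ hdet
    -- Step 2: reindex along `{i // i ≠ i₀} ⊕ Fin 1 ≃ ι` and eliminate
    set e := splitEquiv i₀ with he
    set K := H₁.submatrix e e with hKdef
    have hK : cT L K = K := by rw [hKdef, cT_submatrix, hH₁]
    have hdetK : K.det ≠ 0 := by rwa [hKdef, Matrix.det_submatrix_equiv_self]
    set c := H₁ i₀ i₀ with hcdef
    have hc : c ≠ 0 := hi₀
    have hσc : conjRingHomK L c = c := hermitian_apply L hH₁ i₀ i₀
    obtain ⟨hA, hCB, hBC, -⟩ := blocks_of_hermitian L hK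
    have hD : K.toBlocks₂₂ = c • (1 : Matrix (Fin 1) (Fin 1) L) := by
      rw [toBlocks₂₂_eq_smul_one]
      simp [hKdef, he, hcdef]
    set A := K.toBlocks₁₁
    set B := K.toBlocks₁₂
    set C := K.toBlocks₂₁
    have hKblocks : K = Matrix.fromBlocks A B C (c • (1 : Matrix (Fin 1) (Fin 1) L)) := by
      rw [← hD]; exact (Matrix.fromBlocks_toBlocks K).symm
    set P : Matrix ({i // i ≠ i₀} ⊕ Fin 1) ({i // i ≠ i₀} ⊕ Fin 1) L :=
      Matrix.fromBlocks 1 0 (-(c⁻¹ • C)) (1 : Matrix (Fin 1) (Fin 1) L) with hPdef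
    have hPdet : P.det = 1 := by
      rw [hPdef, Matrix.det_fromBlocks_zero₁₂, Matrix.det_one, Matrix.det_one, one_mul]
    have hstep : cT L P * K * P = Matrix.fromBlocks (A - c⁻¹ • (B * C)) 0 0 (c • (1 : Matrix (Fin 1) (Fin 1) L)) := by
      rw [hKblocks]
      exact schur_step L A B C hc hσc hCB
    -- the Schur complement is hermitian and non-degenerate
    set A' := A - c⁻¹ • (B * C) with hA'def
    have hA' : cT L A' = A' := by
      rw [hA'def, cT_sub, cT_smul, cT_mul, hA, hCB, hBC, map_inv₀, hσc]
    have hdetA' : A'.det ≠ 0 := by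
      have h := congrArg Matrix.det hstep
      rw [Matrix.det_mul, Matrix.det_mul, det_cT, hPdet, map_one, one_mul, mul_one,
        Matrix.det_fromBlocks_zero₂₁, Matrix.det_smul, Matrix.det_one, mul_one, Fintype.card_fin, pow_one] at h
      intro h0
      rw [h0, zero_mul] at h
      exact hdetK h
    -- induction hypothesis on the complement
    have hcardκ : Fintype.card {i // i ≠ i₀} = m := by rw [card_ne]; omega
    obtain ⟨G₃, hG₃, d₃, e₃⟩ := ih {i // i ≠ i₀} hcardκ A' hA' hdetA'
    set Q : Matrix ({i // i ≠ i₀} ⊕ Fin 1) ({i // i ≠ i₀} ⊕ Fin 1) L :=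
      Matrix.fromBlocks G₃ 0 0 (1 : Matrix (Fin 1) (Fin 1) L) with hQdef
    have hQdet : IsUnit Q.det := by
      rw [hQdef, Matrix.det_fromBlocks_zero₂₁, Matrix.det_one, mul_one]; exact hG₃
    have hKdiag : cT L (P * Q) * K * (P * Q) = Matrix.diagonal (Sum.elim d₃ fun _ => c) := by
      calc cT L (P * Q) * K * (P * Q) = cT L Q * (cT L P * K * P) * Q := by
            rw [cT_mul]; simp only [Matrix.mul_assoc]
        _ = Matrix.diagonal (Sum.elim d₃ fun _ => c) := by
            rw [hstep, hQdef, cT_fromBlocks, cT_zero, cT_zero, cT_one, Matrix.fromBlocks_multiply,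
              Matrix.fromBlocks_multiply, ← Matrix.fromBlocks_diagonal, Matrix.smul_one_eq_diagonal]
            simp [e₃]
    -- transport back to `ι`
    refine ⟨G₁ * (P * Q).submatrix e.symm e.symm, ?_, (Sum.elim d₃ fun _ => c) ∘ e.symm, ?_⟩
    · rw [Matrix.det_mul, Matrix.det_submatrix_equiv_self, Matrix.det_mul, hPdet, one_mul]
      exact hG₁.mul hQdet
    · have h := congr_submatrix L e K (P * Q) _ hKdiag
      rw [hKdef, submatrix_submatrix_symm, Matrix.submatrix_diagonal_equiv, hH₁def] at h
      rw [cT_mul, ← h]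
      simp only [Matrix.mul_assoc]

/-- **Every non-degenerate `σ`-hermitian matrix over a CM field is congruent over `L` to a diagonal matrix** with
`σ`-fixed non-zero entries. -/
theorem exists_congr_diagonal [Fintype ι] [DecidableEq ι] (H : Matrix ι ι L) (hH : cT L H = H) (hdet : H.det ≠ 0) :
    ∃ G : Matrix ι ι L, IsUnit G.det ∧ ∃ d : ι → L,
      (∀ i, conjRingHomK L (d i) = d i) ∧ (∀ i, d i ≠ 0) ∧ cT L G * H * G = Matrix.diagonal d := by
  obtain ⟨G, hG, d, e⟩ := exists_congr_diagonal_aux L (Fintype.card ι) ι rfl H hH hdet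
  refine ⟨G, hG, d, fun i => ?_, fun i => ?_, e⟩
  · have h := cT_congr L (G := G) hH
    rw [e] at h
    have hi := congrFun (congrFun h i) i
    simpa [cT_apply] using hi
  · have h := det_congr_ne_zero L hG hdet
    rw [e, Matrix.det_diagonal] at h
    exact (Finset.prod_ne_zero_iff.mp h) i (Finset.mem_univ i)

end Elim

/-! ## §B. The positive index at a complex embedding: eigenvalues of `τ(H)` vs. any diagonalisation over `L` -/

section Spectral

variable {ι : Type} [Fintype ι] [DecidableEq ι]

omit [Fintype ι] [DecidableEq ι] in
/-- `τ(H)` is a hermitian complex matrix. -/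
theorem isHermitian_map {H : Matrix ι ι L} (hH : cT L H = H) (τ : L →+* ℂ) : (H.map τ).IsHermitian := by
  have h := congrArg (fun M : Matrix ι ι L => M.map τ) hH
  simp only [map_cT] at h
  exact h

omit [DecidableEq ι] in
/-- (Ported verbatim from the HodgeCMPerL package; no docstring in the source.) -/
theorem congr_map_embedding {G H D : Matrix ι ι L} (e : cT L G * H * G = D) (τ : L →+* ℂ) :
    (G.map τ)ᴴ * H.map τ * G.map τ = D.map τ := by
  have h := congrArg (fun M : Matrix ι ι L => M.map τ) e
  simp only [Matrix.map_mul, map_cT] at h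
  exact h

/-- (Ported verbatim from the HodgeCMPerL package; no docstring in the source.) -/
theorem isUnit_det_map_embedding {G : Matrix ι ι L} (hG : IsUnit G.det) (τ : L →+* ℂ) : IsUnit (G.map τ).det := by
  rw [← RingHom.mapMatrix_apply, ← RingHom.map_det]
  exact isUnit_iff_ne_zero.mpr ((map_ne_zero τ).mpr hG.ne_zero)

/-- (Ported verbatim from the HodgeCMPerL package; no docstring in the source.) -/
theorem re_rclike_ofReal (r : ℝ) : ((RCLike.ofReal r : ℂ)).re = r := by
  rw [← RCLike.re_to_complex, RCLike.ofReal_re]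

omit [DecidableEq ι] in
/-- (Ported verbatim from the HodgeCMPerL package; no docstring in the source.) -/
theorem card_pos_re_ofReal (f : ι → ℝ) :
    (Finset.univ.filter fun i => 0 < ((RCLike.ofReal ∘ f) i : ℂ).re).card =
      (Finset.univ.filter fun i => 0 < f i).card := by
  simp only [Function.comp_apply, re_rclike_ofReal]

/-- **Sylvester's law of inertia, eigenvalue form.**  If `ᵗ(σG) · H · G = diag d` over `L` with `G` invertible,
then at every complex embedding `τ` the number of positive eigenvalues of the hermitian matrix `τ(H)` equals the
number of `i` with `τ(d i) > 0`. -/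
theorem card_pos_eigenvalues_eq_posCount {H G : Matrix ι ι L} {d : ι → L} (hH : cT L H = H) (hG : IsUnit G.det)
    (e : cT L G * H * G = Matrix.diagonal d) (τ : L →+* ℂ) :
    (Finset.univ.filter fun i => 0 < (isHermitian_map L hH τ).eigenvalues i).card = posCount L τ d := by
  set hA := isHermitian_map L hH τ with hAdef
  set A : Matrix ι ι ℂ := H.map τ with hAmat
  set U : Matrix ι ι ℂ := (hA.eigenvectorUnitary : Matrix ι ι ℂ) with hUdef
  set D : Matrix ι ι ℂ := Matrix.diagonal (RCLike.ofReal ∘ hA.eigenvalues) with hDdef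
  -- the spectral theorem: `Uᴴ A U = D`, `U Uᴴ = 1`
  have hU : Uᴴ * A * U = D := by
    have h := hA.conjStarAlgAut_star_eigenvectorUnitary
    rw [Unitary.conjStarAlgAut_star_apply, Matrix.star_eq_conjTranspose] at h
    exact h
  have hUU : U * Uᴴ = 1 := by
    have h := Unitary.coe_mul_star_self hA.eigenvectorUnitary
    rwa [Unitary.coe_star, Matrix.star_eq_conjTranspose] at h
  have hAeq : U * D * Uᴴ = A := by
    rw [← hU]
    calc U * (Uᴴ * A * U) * Uᴴ = (U * Uᴴ) * A * (U * Uᴴ) := by simp only [Matrix.mul_assoc]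
      _ = A := by rw [hUU, Matrix.one_mul, Matrix.mul_one]
  -- the `L`-diagonalisation seen at `τ`: `Gτᴴ A Gτ = diag (τ d)`, `Gτ` invertible
  set Gτ : Matrix ι ι ℂ := G.map τ with hGτdef
  have eτ : Gτᴴ * A * Gτ = Matrix.diagonal fun i => τ (d i) := by
    have h := congr_map_embedding L e τ
    rwa [Matrix.diagonal_map (map_zero τ)] at h
  have hGτ : IsUnit Gτ.det := isUnit_det_map_embedding L hG τ
  apply le_antisymm
  · -- `#pos eigenvalues ≤ posCount`: congruence `(Gτ⁻¹ U)ᴴ · diag (τ d) · (Gτ⁻¹ U) = D`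
    have hW1 : Gτ * Gτ⁻¹ = 1 := Matrix.mul_nonsing_inv Gτ hGτ
    have hWc : Gτ⁻¹ᴴ * Gτᴴ = 1 := by rw [← Matrix.conjTranspose_mul, hW1, Matrix.conjTranspose_one]
    have h2 : (Gτ⁻¹ * U)ᴴ * (Matrix.diagonal fun i => τ (d i)) * (Gτ⁻¹ * U) = D := by
      rw [← eτ, Matrix.conjTranspose_mul]
      calc Uᴴ * Gτ⁻¹ᴴ * (Gτᴴ * A * Gτ) * (Gτ⁻¹ * U) = Uᴴ * (Gτ⁻¹ᴴ * Gτᴴ) * A * (Gτ * Gτ⁻¹) * U := by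
            simp only [Matrix.mul_assoc]
        _ = D := by rw [hWc, hW1, Matrix.mul_one, Matrix.mul_one, hU]
    have h := card_pos_le_of_congr h2
    rwa [card_pos_re_ofReal] at h
  · -- `posCount ≤ #pos eigenvalues`: congruence `(Uᴴ Gτ)ᴴ · D · (Uᴴ Gτ) = diag (τ d)`
    have h1 : (Uᴴ * Gτ)ᴴ * D * (Uᴴ * Gτ) = Matrix.diagonal fun i => τ (d i) := by
      rw [Matrix.conjTranspose_mul, Matrix.conjTranspose_conjTranspose, ← eτ, ← hAeq]
      simp only [Matrix.mul_assoc]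
    have h := card_pos_le_of_congr h1
    rwa [card_pos_re_ofReal] at h

end Spectral

/-! ## §C. Landherr's theorem for hermitian matrices -/

section Main

variable {ι : Type} [Fintype ι] [DecidableEq ι]

/-- The class of `x / y` in `L₀^× / N(L^×)` does not change when `x` and `y` are multiplied by norms. -/
theorem normClass_mul_norm_iff {x y u v : L} (hu : u ≠ 0) (hv : v ≠ 0) :
    (∃ z : L, z ≠ 0 ∧ x * (u * conjRingHomK L u) = y * (v * conjRingHomK L v) * (z * conjRingHomK L z)) ↔
      ∃ z : L, z ≠ 0 ∧ x = y * (z * conjRingHomK L z) := by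
  have hσu : conjRingHomK L u ≠ 0 := (map_ne_zero _).mpr hu
  have hσv : conjRingHomK L v ≠ 0 := (map_ne_zero _).mpr hv
  constructor
  · rintro ⟨z, hz, h⟩
    refine ⟨v * z / u, div_ne_zero (mul_ne_zero hv hz) hu, ?_⟩
    rw [map_div₀, map_mul]
    field_simp
    linear_combination h
  · rintro ⟨z, hz, h⟩
    refine ⟨z * u / v, div_ne_zero (mul_ne_zero hz hu) hv, ?_⟩
    rw [map_div₀, map_mul, h]
    field_simp

/-- `∏ dᵢ = det H · N(det G)` for a diagonalisation `ᵗ(σG) · H · G = diag d`. -/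
theorem prod_eq_det_mul_norm {H G : Matrix ι ι L} {d : ι → L} (e : cT L G * H * G = Matrix.diagonal d) :
    ∏ i, d i = H.det * (G.det * conjRingHomK L G.det) := by
  have h := congrArg Matrix.det e
  rw [Matrix.det_mul, Matrix.det_mul, det_cT, Matrix.det_diagonal] at h
  rw [← h]
  ring

/-- A hermitian matrix is recovered from a diagonalisation: `H = ᵗ(σG⁻¹) · diag d · G⁻¹`. -/
theorem eq_congr_inv_diagonal {H G : Matrix ι ι L} {d : ι → L} (hG : IsUnit G.det)
    (e : cT L G * H * G = Matrix.diagonal d) : H = cT L G⁻¹ * Matrix.diagonal d * G⁻¹ := by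
  have hW : G * G⁻¹ = 1 := Matrix.mul_nonsing_inv G hG
  rw [← e]
  calc H = cT L (G * G⁻¹) * H * (G * G⁻¹) := by rw [hW, cT_one, Matrix.one_mul, Matrix.mul_one]
    _ = cT L G⁻¹ * (cT L G * H * G) * G⁻¹ := by rw [cT_mul]; simp only [Matrix.mul_assoc]


-- port_pkg: scope closed for this part
end Main
end LandherrRankN
end HodgeCM
end
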